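import Literature.AlgebraicGeometry.Motives.AbelianVarietyDihedralOrderEightBrauerRelations
import HarnessLib

/-!
# The Brauer relation lattice of `C_3 × S_3 = (C_3 ⋊ 1) × (C_3 ⋊ C_2)` in full: rank `3`, Bartel–Dokchitser's
# PRIMITIVE relation `Θ = G − C_2 + (C_6 − G) + (S_3 − G) + (C_3^Δ − C_3²)` (Theorem A, case (3)(b) with `l = 3`,
# `P_1 = 1`, `P_2 = C_2`: `Q = C_2 ≠ 1`, so `Prim(G) ≅ ℤ/2ℤ`), and `K(G) = ℤΘ ⊕ ℤInd_{S_3} ⊕ ℤInf_{G/C_3}`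

Layer A1/A2 of the Hodge foundations lane (`lit-hodgefound`, row A1-20⁺ · A2, seat p03 generation 28, row g28-#14) on
the ALGEBRAIC carrier; sequel of `Motives/AbelianVarietyDihedralOrderEightBrauerRelations` (g28-#2; same method;
CONSUMED: `indClassFun_one_apply_eq_div`, `card_conj_mem_bot`, `indClassFun_top_one`,
`mem_ker_linearCombination_indClassFun_one_iff`).  Bartel–Dokchitser, Theorem A (3)(b): `G = (C_l ⋊ P_1) × (C_l ⋊ P_2)`
with cyclic (possibly trivial) `p`-groups `P_i` acting faithfully on `C_l × C_l`, `l ≠ p`; table: `Prim(G) ≅ ℤ` if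
`Q = P_1 × P_2 = 1`, `ℤ/pℤ` else; basis (soluble `G ≅ 𝔽_l^d ⋊ Q`, `d > 1`):
`Θ = G − Q + Σ_U (U ⋊ N_Q U − 𝔽_l^d ⋊ N_Q U)`, sum over the lines `U ⊂ 𝔽_l^d` up to `G`-conjugacy.  The SMALLEST
instance is `G = C_3 × S_3` (`l = 3`, `d = 2`, `P_1 = 1`, `P_2 = C_2 = Q`, `p = 2`), here on Mathlib's
`Multiplicative (ZMod 3) × DihedralGroup 3`: the four lines of `𝔽_3² = C_3 × C_3` are `U_1 = C_3 × 1` and `U_2 = 1 × C_3`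
(`Q`-stable, `N_Q U = Q`) and the two "diagonals" `C_3^Δ = ⟨(1, r)⟩ ~ ⟨(1, r²)⟩` (swapped by `Q`, `N_Q U = 1`), so
**`Θ = G − C_2 + (C_6 − G) + (S_3 − G) + (C_3^Δ − C_3²) = −C_2 + C_3^Δ + C_6 + S_3 − C_3² − G`**.  NINE classes of
subgroups `1, C_2 = ⟨(0, τ)⟩, C_3 × 1, 1 × C_3, C_3^Δ, C_6 = ⟨(1, τ)⟩, S_3 = 1 × S_3, C_3², G`; six cyclic, so
**`rank K(G) = 3`** (§2); all nine permutation characters explicit (§2), the six class equations solved (§3: **`a ∈ K`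
iff `a_{1×C_3} = −a_1`, `a_{C_3^Δ} = −2a_1 − a_{C_2}`, `a_{C_6} = −2a_1 − a_{C_2} − 2a_{C_3×1}`, `a_{S_3} = −a_{C_2}`,
`a_{C_3²} = 2a_1 + a_{C_2} − a_{C_3×1}`, `a_G = 2a_1 + a_{C_2} + 2a_{C_3×1}`**), the ℤ-basis **`Θ`,
`Ind_{S_3} = 1 − 2C_2 − (1×C_3) + 2S_3` (Example 2 induced), `Inf = (C_3×1) − 2C_6 − C_3² + 2G` (Example 2 lifted from
`G/(C_3 × 1) ≅ S_3`)**, and `Prim(G) = ℤ/2ℤ` concretely: the imprimitive part `Imprim` is spanned by `Ind_{S_3}`, `Inf`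
and `Ind_{C_3²} = 1 − (C_3×1) − (1×C_3) − 2C_3^Δ + 3C_3²` (Example 3 induced; the remaining proper subquotients are
cyclic or `S_3 ≅ G/(C_3×1)`-images already listed), on it `a_G` is EVEN, on `Θ` it is `−1`;
**`2Θ = Ind_{S_3} − Ind_{C_3²} − Inf ∈ Imprim`**, `Θ ∉ Imprim`, `K = ℤΘ + Imprim`.  Everything here is PROVED; NO
definition, NO named fact (net Literature debt 0).

## Sources, verbatim

A. Bartel, T. Dokchitser, *Brauer relations in finite groups*, J. Eur. Math. Soc. **17** (2015) (arXiv 1103.2047, held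
`paper:arxiv-1103.2047`).  §1.1 Theorem A (3) (p0003): "[…] or (b) `G = (C_l ⋊ P_1) × (C_l ⋊ P_2)` with cyclic
(possibly trivial) `p`-groups `P_i` that act faithfully on `C_l × C_l` with `l ≠ p` prime"; table, case 3b: "`ℤ` if
`Q = {1}`, `ℤ/pℤ` if `Q ≠ {1}` (`Q = P_1 × P_2`)"; basis for `G ≅ 𝔽_l^d ⋊ Q` soluble, `d > 1`:
"`Θ = G − Q + Σ_U (U ⋊ N_Q U − 𝔽_l^d ⋊ N_Q U)`; sum over `U ⊂ 𝔽_l^d` of index `l` up to `G`-conjugacy".  §2 (p0006):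
Induction, Inflation, "the rank of `K(G)` is the number of conjugacy classes of non-cyclic subgroups", Example 2
(`S_3`), Example 3 (`C_p × C_p`: `1 − Σ_C C + pG`).

## Dictionary and what is proved (namespace `Literature.AlgebraicGeometry.Motives.AbelianVariety`)

`G = Multiplicative (ZMod 3) × DihedralGroup 3`, `z = (ofAdd 1, 1)`, `τ = (1, sr 0)`, `ρ = (1, r 1)`.  Representatives
(indices `0…8`): `![⊥, zpowers τ, zpowers z, zpowers ρ, zpowers (zρ), zpowers (zτ), ⊥.prod ⊤, ⊤.prod (zpowers (r 1)),
⊤]`; classes: `1`, `{(0, reflection)}`, `{(≠0, 1)}`, `{(0, rotation ≠ 1)}`, `{(≠0, rotation ≠ 1)}`, `{(≠0, reflection)}`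
via the predicates `g.1 = 1`, `g.2 = 1`, `g.2³ = 1`; `Θ = ![0, -1, 0, 0, 1, 1, 1, -1, -1]`,
`Ind_{S_3} = ![1, -2, 0, -1, 0, 0, 2, 0, 0]`, `Inf = ![0, 0, 1, 0, 0, -2, 0, -1, 2]`,
`Ind_{C_3²} = ![1, 0, -1, -1, -2, 0, 0, 3, 0]`; `𝒦` any `Submodule ℤ (Fin 9 → ℤ)` with `a ∈ 𝒦 ↔ Σ_i a_i (1_{H_i})^G = 0`.

* §1 `orderOf_generators_cyclicTimesSymThree`, `mem_prod_bot_top_cyclicTimesSymThree_iff`,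
  `mem_prod_top_zpowers_cyclicTimesSymThree_iff`, `natCard_subgroups_cyclicTimesSymThree`.
* §2 `card_conj_mem_*_cyclicTimesSymThree` (seven marks functions), **`indClassFun_one_apply_cyclicTimesSymThree`**.
* §3 `sum_smul_indClassFun_cyclicTimesSymThree_apply`, **`sum_smul_indClassFun_cyclicTimesSymThree_eq_zero_iff`**,
  **`relations_mem_cyclicTimesSymThree`** (`Θ`, `Ind_{S_3}`, `Inf`, `Ind_{C_3²}`), **`two_smul_thetaPrim_eq_cyclicTimesSymThree`**.
* §4 `mem_brauerRelations_cyclicTimesSymThree_iff`, **`eq_combination_of_mem_brauerRelations_cyclicTimesSymThree`**,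
  **`brauerRelations_cyclicTimesSymThree_eq_span`**, `linearIndependent_basis_cyclicTimesSymThree`,
  `ker_linearCombination_indClassFun_one_cyclicTimesSymThree_eq_span`,
  **`finrank_ker_linearCombination_indClassFun_one_cyclicTimesSymThree`** (`= 3`),
  **`thetaPrim_not_mem_span_imprimitive_cyclicTimesSymThree`**, `two_smul_thetaPrim_mem_span_imprimitive_cyclicTimesSymThree`,
  **`brauerRelations_cyclicTimesSymThree_eq_span_thetaPrim_sup_imprimitive`**.

## References

* [BartelDokchitser2015] A. Bartel, T. Dokchitser, *Brauer relations in finite groups*, JEMS 17 (2015), §1.1 Theorem A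
  (3)(b) and its table, §2 (Induction, Inflation, rank, Examples 2–3).
-/

noncomputable section

universe u

open CategoryTheory CategoryTheory.Limits
open Literature.RepresentationTheory.FiniteGroups

namespace Literature.AlgebraicGeometry.Motives

namespace AbelianVariety

open DihedralGroup

/-! ## §1 `G = C_3 × S_3`: generators, orders, the subgroups `1 × S_3` and `C_3 × C_3` -/

section CyclicTimesSymThreeGroup

/-- Orders: `τ = (1, sr 0)` has order `2`; `z = (ofAdd 1, 1)`, `ρ = (1, r 1)`, `zρ` have order `3`; `zτ` has order `6`.
[cite: BartelDokchitser2015, §2 ("cyclic subgroups")] -/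
theorem orderOf_generators_cyclicTimesSymThree :
    orderOf ((1, sr 0) : Multiplicative (ZMod 3) × DihedralGroup 3) = 2 ∧ orderOf ((Multiplicative.ofAdd (1 : ZMod 3), (1 : DihedralGroup 3)) : Multiplicative (ZMod 3) × DihedralGroup 3) = 3 ∧ orderOf ((1, r 1) : Multiplicative (ZMod 3) × DihedralGroup 3) = 3 ∧ orderOf ((Multiplicative.ofAdd (1 : ZMod 3), r 1) : Multiplicative (ZMod 3) × DihedralGroup 3) = 3 ∧ orderOf ((Multiplicative.ofAdd (1 : ZMod 3), sr 0) : Multiplicative (ZMod 3) × DihedralGroup 3) = 6 := by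
  haveI : Fact (Nat.Prime 3) := ⟨Nat.prime_three⟩
  refine ⟨?_, ?_, ?_, ?_, ?_⟩
  · rw [orderOf_eq_prime_iff (p := 2)]; decide
  · rw [orderOf_eq_prime_iff (p := 3)]; decide
  · rw [orderOf_eq_prime_iff (p := 3)]; decide
  · rw [orderOf_eq_prime_iff (p := 3)]; decide
  · rw [orderOf_eq_iff (by norm_num)]; decide

/-- `y ∈ ⟨g⟩ ↔ y ∈ {g^k : k < orderOf g}`. [folklore] -/
private theorem mem_zpowers_c3s3_iff (g : Multiplicative (ZMod 3) × DihedralGroup 3) {m : ℕ} (hm : orderOf g = m) (y : Multiplicative (ZMod 3) × DihedralGroup 3) :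
    y ∈ Subgroup.zpowers g ↔ y ∈ (Finset.range m).image (g ^ ·) := by
  rw [mem_zpowers_iff_mem_range_orderOf, hm]

/-- **`y ∈ 1 × S_3 ↔ y.1 = 1`.** [cite: BartelDokchitser2015, §1.1 Theorem A (3)(b) ("C_l ⋊ P_2")] -/
theorem mem_prod_bot_top_cyclicTimesSymThree_iff (y : Multiplicative (ZMod 3) × DihedralGroup 3) :
    y ∈ (⊥ : Subgroup (Multiplicative (ZMod 3))).prod (⊤ : Subgroup (DihedralGroup 3)) ↔ y.1 = 1 := by
  rw [Subgroup.mem_prod, Subgroup.mem_bot]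
  simp only [Subgroup.mem_top, and_true]

/-- **`y ∈ C_3 × C_3 = C_3 × ⟨r 1⟩ ↔ y.2 ∈ {1, r, r²}`.** [cite: BartelDokchitser2015, §1.1 Theorem A (3)(b) ("C_l × C_l")] -/
theorem mem_prod_top_zpowers_cyclicTimesSymThree_iff (y : Multiplicative (ZMod 3) × DihedralGroup 3) :
    y ∈ (⊤ : Subgroup (Multiplicative (ZMod 3))).prod (Subgroup.zpowers (r 1 : DihedralGroup 3)) ↔
      y.2 ∈ (Finset.range 3).image ((r 1 : DihedralGroup 3) ^ ·) := by
  rw [Subgroup.mem_prod, mem_zpowers_iff_mem_range_orderOf, orderOf_r_one]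
  simp only [Subgroup.mem_top, true_and]

end CyclicTimesSymThreeGroup

/-! ## §2 The marks and the nine permutation characters, machine-checked -/

section CyclicTimesSymThreeMarks

/-- `|{y : Q y}|` as a filter cardinality. [folklore] -/
private theorem natCard_subtype_eq_card_filter_c3s3 (P : Multiplicative (ZMod 3) × DihedralGroup 3 → Prop) [DecidablePred P]
    (Q : Multiplicative (ZMod 3) × DihedralGroup 3 → Prop) (hQP : ∀ y, Q y ↔ P y) :
    Nat.card {y : Multiplicative (ZMod 3) × DihedralGroup 3 // Q y} = (Finset.univ.filter P).card := by
  rw [← Fintype.card_subtype, ← Nat.card_eq_fintype_card]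
  exact Nat.card_congr (Equiv.subtypeEquivRight hQP)

/-- **Marks of `C_2 = ⟨(0, τ)⟩`**: `18` at `1`, `6` on `{(0, reflection)}`. [cite: BartelDokchitser2015, §2] -/
theorem card_conj_mem_tau_cyclicTimesSymThree (g : Multiplicative (ZMod 3) × DihedralGroup 3) :
    Nat.card {y : Multiplicative (ZMod 3) × DihedralGroup 3 // y⁻¹ * g * y ∈ Subgroup.zpowers ((1, sr 0) : Multiplicative (ZMod 3) × DihedralGroup 3)} =
      if g = 1 then 18 else if g.1 = 1 ∧ ¬ g.2 ^ 3 = 1 then 6 else 0 := by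
  classical
  rw [natCard_subtype_eq_card_filter_c3s3 _ _ fun y ↦ mem_zpowers_c3s3_iff _ orderOf_generators_cyclicTimesSymThree.1 _]
  revert g
  decide

/-- **Marks of `C_3 × 1 = ⟨z⟩` (central)**: `18·[g.2 = 1]`. [cite: BartelDokchitser2015, §2] -/
theorem card_conj_mem_z_cyclicTimesSymThree (g : Multiplicative (ZMod 3) × DihedralGroup 3) :
    Nat.card {y : Multiplicative (ZMod 3) × DihedralGroup 3 // y⁻¹ * g * y ∈ Subgroup.zpowers ((Multiplicative.ofAdd (1 : ZMod 3), (1 : DihedralGroup 3)) : Multiplicative (ZMod 3) × DihedralGroup 3)} = if g.2 = 1 then 18 else 0 := by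
  classical
  rw [natCard_subtype_eq_card_filter_c3s3 _ _ fun y ↦ mem_zpowers_c3s3_iff _ orderOf_generators_cyclicTimesSymThree.2.1 _]
  revert g
  decide

/-- **Marks of `1 × C_3 = ⟨ρ⟩ ⊴ G`**: `18·[g.1 = 1 ∧ g.2³ = 1]`. [cite: BartelDokchitser2015, §2] -/
theorem card_conj_mem_rho_cyclicTimesSymThree (g : Multiplicative (ZMod 3) × DihedralGroup 3) :
    Nat.card {y : Multiplicative (ZMod 3) × DihedralGroup 3 // y⁻¹ * g * y ∈ Subgroup.zpowers ((1, r 1) : Multiplicative (ZMod 3) × DihedralGroup 3)} = if g.1 = 1 ∧ g.2 ^ 3 = 1 then 18 else 0 := by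
  classical
  rw [natCard_subtype_eq_card_filter_c3s3 _ _ fun y ↦ mem_zpowers_c3s3_iff _ orderOf_generators_cyclicTimesSymThree.2.2.1 _]
  revert g
  decide

/-- **Marks of the diagonal `C_3^Δ = ⟨zρ⟩`**: `18` at `1`, `9` on `{(≠0, rotation ≠ 1)}`. [cite: BartelDokchitser2015, §1.1 Theorem A (table: the lines U)] -/
theorem card_conj_mem_zrho_cyclicTimesSymThree (g : Multiplicative (ZMod 3) × DihedralGroup 3) :
    Nat.card {y : Multiplicative (ZMod 3) × DihedralGroup 3 // y⁻¹ * g * y ∈ Subgroup.zpowers ((Multiplicative.ofAdd (1 : ZMod 3), r 1) : Multiplicative (ZMod 3) × DihedralGroup 3)} =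
      if g = 1 then 18 else if ¬ g.1 = 1 ∧ g.2 ^ 3 = 1 ∧ ¬ g.2 = 1 then 9 else 0 := by
  classical
  rw [natCard_subtype_eq_card_filter_c3s3 _ _ fun y ↦ mem_zpowers_c3s3_iff _ orderOf_generators_cyclicTimesSymThree.2.2.2.1 _]
  revert g
  decide

/-- **Marks of `C_6 = ⟨zτ⟩`**: `18` on `C_3 × 1`, `6` on the elements `(·, reflection)`. [cite: BartelDokchitser2015, §2] -/
theorem card_conj_mem_ztau_cyclicTimesSymThree (g : Multiplicative (ZMod 3) × DihedralGroup 3) :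
    Nat.card {y : Multiplicative (ZMod 3) × DihedralGroup 3 // y⁻¹ * g * y ∈ Subgroup.zpowers ((Multiplicative.ofAdd (1 : ZMod 3), sr 0) : Multiplicative (ZMod 3) × DihedralGroup 3)} =
      if g.2 = 1 then 18 else if ¬ g.2 ^ 3 = 1 then 6 else 0 := by
  classical
  rw [natCard_subtype_eq_card_filter_c3s3 _ _ fun y ↦ mem_zpowers_c3s3_iff _ orderOf_generators_cyclicTimesSymThree.2.2.2.2 _]
  revert g
  decide

/-- **Marks of `1 × S_3 ⊴ G`**: `18·[g.1 = 1]`. [cite: BartelDokchitser2015, §2 (Example 2)] -/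
theorem card_conj_mem_prod_bot_top_cyclicTimesSymThree (g : Multiplicative (ZMod 3) × DihedralGroup 3) :
    Nat.card {y : Multiplicative (ZMod 3) × DihedralGroup 3 // y⁻¹ * g * y ∈ (⊥ : Subgroup (Multiplicative (ZMod 3))).prod (⊤ : Subgroup (DihedralGroup 3))} =
      if g.1 = 1 then 18 else 0 := by
  classical
  rw [natCard_subtype_eq_card_filter_c3s3 _ _ fun y ↦ mem_prod_bot_top_cyclicTimesSymThree_iff _]
  revert g
  decide

/-- **Marks of `C_3 × C_3 ⊴ G`**: `18·[g.2³ = 1]`. [cite: BartelDokchitser2015, §2 (Example 3)] -/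
theorem card_conj_mem_prod_top_zpowers_cyclicTimesSymThree (g : Multiplicative (ZMod 3) × DihedralGroup 3) :
    Nat.card {y : Multiplicative (ZMod 3) × DihedralGroup 3 // y⁻¹ * g * y ∈ (⊤ : Subgroup (Multiplicative (ZMod 3))).prod (Subgroup.zpowers (r 1 : DihedralGroup 3))} =
      if g.2 ^ 3 = 1 then 18 else 0 := by
  classical
  rw [natCard_subtype_eq_card_filter_c3s3 _ _ fun y ↦ mem_prod_top_zpowers_cyclicTimesSymThree_iff _]
  revert g
  decide

/-- The orders `2, 3, 3, 3, 6, 6, 9` of the representatives and `|G| = 18`. [cite: BartelDokchitser2015, §2] -/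
theorem natCard_subgroups_cyclicTimesSymThree :
    Nat.card (Subgroup.zpowers ((1, sr 0) : Multiplicative (ZMod 3) × DihedralGroup 3)) = 2 ∧ Nat.card (Subgroup.zpowers ((Multiplicative.ofAdd (1 : ZMod 3), (1 : DihedralGroup 3)) : Multiplicative (ZMod 3) × DihedralGroup 3)) = 3 ∧ Nat.card (Subgroup.zpowers ((1, r 1) : Multiplicative (ZMod 3) × DihedralGroup 3)) = 3 ∧
    Nat.card (Subgroup.zpowers ((Multiplicative.ofAdd (1 : ZMod 3), r 1) : Multiplicative (ZMod 3) × DihedralGroup 3)) = 3 ∧ Nat.card (Subgroup.zpowers ((Multiplicative.ofAdd (1 : ZMod 3), sr 0) : Multiplicative (ZMod 3) × DihedralGroup 3)) = 6 ∧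
    Nat.card ↥((⊥ : Subgroup (Multiplicative (ZMod 3))).prod (⊤ : Subgroup (DihedralGroup 3))) = 6 ∧
    Nat.card ↥((⊤ : Subgroup (Multiplicative (ZMod 3))).prod (Subgroup.zpowers (r 1 : DihedralGroup 3))) = 9 ∧
    Fintype.card (Multiplicative (ZMod 3) × DihedralGroup 3) = 18 := by
  classical
  obtain ⟨o1, o2, o3, o4, o5⟩ := orderOf_generators_cyclicTimesSymThree
  refine ⟨?_, ?_, ?_, ?_, ?_, ?_, ?_, ?_⟩
  · rw [Nat.card_zpowers, o1]
  · rw [Nat.card_zpowers, o2]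
  · rw [Nat.card_zpowers, o3]
  · rw [Nat.card_zpowers, o4]
  · rw [Nat.card_zpowers, o5]
  · show Nat.card {y : Multiplicative (ZMod 3) × DihedralGroup 3 // y ∈ (⊥ : Subgroup (Multiplicative (ZMod 3))).prod (⊤ : Subgroup (DihedralGroup 3))} = 6
    rw [natCard_subtype_eq_card_filter_c3s3 _ (· ∈ (⊥ : Subgroup (Multiplicative (ZMod 3))).prod (⊤ : Subgroup (DihedralGroup 3)))
      mem_prod_bot_top_cyclicTimesSymThree_iff]
    decide
  · show Nat.card {y : Multiplicative (ZMod 3) × DihedralGroup 3 // y ∈ (⊤ : Subgroup (Multiplicative (ZMod 3))).prod (Subgroup.zpowers (r 1 : DihedralGroup 3))} = 9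
    rw [natCard_subtype_eq_card_filter_c3s3 _ (· ∈ (⊤ : Subgroup (Multiplicative (ZMod 3))).prod (Subgroup.zpowers (r 1 : DihedralGroup 3)))
      mem_prod_top_zpowers_cyclicTimesSymThree_iff]
    decide
  · decide

/-- **The nine permutation characters of `C_3 × S_3` as explicit functions** (values on the classes `1`,
`(0, refl)`, `(≠0, 1)`, `(0, rot≠1)`, `(≠0, rot≠1)`, `(≠0, refl)`: `18,0,0,0,0,0`; `9,3,0,0,0,0`; `6,0,6,0,0,0`;
`6,0,0,6,0,0`; `6,0,0,0,3,0`; `3,1,3,0,0,1`; `3,3,0,3,0,0`; `2,0,2,2,2,0`; `1`). [cite: BartelDokchitser2015, §1.1 ("Θ ∈ K(G) ⟺ Σ_i n_i Ind 1_{H_i} = 0")] -/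
theorem indClassFun_one_apply_cyclicTimesSymThree (g : Multiplicative (ZMod 3) × DihedralGroup 3) :
    indClassFun (⊥ : Subgroup (Multiplicative (ZMod 3) × DihedralGroup 3)) 1 g = (if g = 1 then (18 : ℂ) else 0) ∧
    indClassFun (Subgroup.zpowers ((1, sr 0) : Multiplicative (ZMod 3) × DihedralGroup 3)) 1 g = (if g = 1 then (9 : ℂ) else if g.1 = 1 ∧ ¬ g.2 ^ 3 = 1 then 3 else 0) ∧
    indClassFun (Subgroup.zpowers ((Multiplicative.ofAdd (1 : ZMod 3), (1 : DihedralGroup 3)) : Multiplicative (ZMod 3) × DihedralGroup 3)) 1 g = (if g.2 = 1 then (6 : ℂ) else 0) ∧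
    indClassFun (Subgroup.zpowers ((1, r 1) : Multiplicative (ZMod 3) × DihedralGroup 3)) 1 g = (if g.1 = 1 ∧ g.2 ^ 3 = 1 then (6 : ℂ) else 0) ∧
    indClassFun (Subgroup.zpowers ((Multiplicative.ofAdd (1 : ZMod 3), r 1) : Multiplicative (ZMod 3) × DihedralGroup 3)) 1 g = (if g = 1 then (6 : ℂ) else if ¬ g.1 = 1 ∧ g.2 ^ 3 = 1 ∧ ¬ g.2 = 1 then 3 else 0) ∧
    indClassFun (Subgroup.zpowers ((Multiplicative.ofAdd (1 : ZMod 3), sr 0) : Multiplicative (ZMod 3) × DihedralGroup 3)) 1 g = (if g.2 = 1 then (3 : ℂ) else if ¬ g.2 ^ 3 = 1 then 1 else 0) ∧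
    indClassFun ((⊥ : Subgroup (Multiplicative (ZMod 3))).prod (⊤ : Subgroup (DihedralGroup 3))) 1 g = (if g.1 = 1 then (3 : ℂ) else 0) ∧
    indClassFun ((⊤ : Subgroup (Multiplicative (ZMod 3))).prod (Subgroup.zpowers (r 1 : DihedralGroup 3))) 1 g = (if g.2 ^ 3 = 1 then (2 : ℂ) else 0) ∧
    indClassFun (⊤ : Subgroup (Multiplicative (ZMod 3) × DihedralGroup 3)) 1 g = 1 := by
  classical
  obtain ⟨c1, c2, c3, c4, c5, c6, c7, c8⟩ := natCard_subgroups_cyclicTimesSymThree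
  refine ⟨?_, ?_, ?_, ?_, ?_, ?_, ?_, ?_, ?_⟩
  · rw [indClassFun_one_apply_eq_div, card_conj_mem_bot, Subgroup.card_bot, c8]
    split_ifs <;> norm_num
  · rw [indClassFun_one_apply_eq_div, card_conj_mem_tau_cyclicTimesSymThree, c1]
    split_ifs <;> norm_num
  · rw [indClassFun_one_apply_eq_div, card_conj_mem_z_cyclicTimesSymThree, c2]
    split_ifs <;> norm_num
  · rw [indClassFun_one_apply_eq_div, card_conj_mem_rho_cyclicTimesSymThree, c3]
    split_ifs <;> norm_num
  · rw [indClassFun_one_apply_eq_div, card_conj_mem_zrho_cyclicTimesSymThree, c4]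
    split_ifs <;> norm_num
  · rw [indClassFun_one_apply_eq_div, card_conj_mem_ztau_cyclicTimesSymThree, c5]
    split_ifs <;> norm_num
  · rw [indClassFun_one_apply_eq_div, card_conj_mem_prod_bot_top_cyclicTimesSymThree, c6]
    split_ifs <;> norm_num
  · rw [indClassFun_one_apply_eq_div, card_conj_mem_prod_top_zpowers_cyclicTimesSymThree, c7]
    split_ifs <;> norm_num
  · rw [indClassFun_top_one, Pi.one_apply]

end CyclicTimesSymThreeMarks

/-! ## §3 The six class equations; `Θ`, `Ind_{S_3}`, `Inf`, `Ind_{C_3²}` -/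

section CyclicTimesSymThreeRelations

/-- The eighteen elements. [folklore] -/
private theorem cyclicTimesSymThree_cases (g : Multiplicative (ZMod 3) × DihedralGroup 3) : g = (1, r 0) ∨
      g = (1, r 1) ∨
      g = (1, r 2) ∨
      g = (1, sr 0) ∨
      g = (1, sr 1) ∨
      g = (1, sr 2) ∨
      g = (Multiplicative.ofAdd (1 : ZMod 3), r 0) ∨
      g = (Multiplicative.ofAdd (1 : ZMod 3), r 1) ∨
      g = (Multiplicative.ofAdd (1 : ZMod 3), r 2) ∨
      g = (Multiplicative.ofAdd (1 : ZMod 3), sr 0) ∨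
      g = (Multiplicative.ofAdd (1 : ZMod 3), sr 1) ∨
      g = (Multiplicative.ofAdd (1 : ZMod 3), sr 2) ∨
      g = (Multiplicative.ofAdd (2 : ZMod 3), r 0) ∨
      g = (Multiplicative.ofAdd (2 : ZMod 3), r 1) ∨
      g = (Multiplicative.ofAdd (2 : ZMod 3), r 2) ∨
      g = (Multiplicative.ofAdd (2 : ZMod 3), sr 0) ∨
      g = (Multiplicative.ofAdd (2 : ZMod 3), sr 1) ∨
      g = (Multiplicative.ofAdd (2 : ZMod 3), sr 2) := by
  revert g
  decide

/-- A nine-term sum of scalar multiples of functions, evaluated at a point. [folklore] -/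
private theorem sum_fin_nine_smul_apply_c3s3 (a : Fin 9 → ℤ) (F : Fin 9 → Multiplicative (ZMod 3) × DihedralGroup 3 → ℂ) (g : Multiplicative (ZMod 3) × DihedralGroup 3) :
    (∑ i : Fin 9, (a i : ℂ) • F i) g = a 0 * F 0 g + a 1 * F 1 g + a 2 * F 2 g + a 3 * F 3 g + a 4 * F 4 g +
      a 5 * F 5 g + a 6 * F 6 g + a 7 * F 7 g + a 8 * F 8 g := by
  simp [Finset.sum_apply, Fin.sum_univ_succ]
  ring

/-- The signed-sum test on the nine representatives, pointwise. [cite: BartelDokchitser2015, §1.1] -/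
theorem sum_smul_indClassFun_cyclicTimesSymThree_apply (a : Fin 9 → ℤ) (g : Multiplicative (ZMod 3) × DihedralGroup 3) :
    (∑ i : Fin 9, (a i : ℂ) • indClassFun ((![⊥,
        Subgroup.zpowers ((1, sr 0) : Multiplicative (ZMod 3) × DihedralGroup 3),
        Subgroup.zpowers ((Multiplicative.ofAdd (1 : ZMod 3), (1 : DihedralGroup 3)) : Multiplicative (ZMod 3) × DihedralGroup 3),
        Subgroup.zpowers ((1, r 1) : Multiplicative (ZMod 3) × DihedralGroup 3),
        Subgroup.zpowers ((Multiplicative.ofAdd (1 : ZMod 3), r 1) : Multiplicative (ZMod 3) × DihedralGroup 3),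
        Subgroup.zpowers ((Multiplicative.ofAdd (1 : ZMod 3), sr 0) : Multiplicative (ZMod 3) × DihedralGroup 3),
        (⊥ : Subgroup (Multiplicative (ZMod 3))).prod (⊤ : Subgroup (DihedralGroup 3)),
        (⊤ : Subgroup (Multiplicative (ZMod 3))).prod (Subgroup.zpowers (r 1 : DihedralGroup 3)),
        ⊤] :
        Fin 9 → Subgroup (Multiplicative (ZMod 3) × DihedralGroup 3)) i) 1) g =
      a 0 * (if g = 1 then (18 : ℂ) else 0) + a 1 * (if g = 1 then (9 : ℂ) else if g.1 = 1 ∧ ¬ g.2 ^ 3 = 1 then 3 else 0) +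
        a 2 * (if g.2 = 1 then (6 : ℂ) else 0) + a 3 * (if g.1 = 1 ∧ g.2 ^ 3 = 1 then (6 : ℂ) else 0) +
        a 4 * (if g = 1 then (6 : ℂ) else if ¬ g.1 = 1 ∧ g.2 ^ 3 = 1 ∧ ¬ g.2 = 1 then 3 else 0) +
        a 5 * (if g.2 = 1 then (3 : ℂ) else if ¬ g.2 ^ 3 = 1 then 1 else 0) +
        a 6 * (if g.1 = 1 then (3 : ℂ) else 0) + a 7 * (if g.2 ^ 3 = 1 then (2 : ℂ) else 0) + a 8 := by
  obtain ⟨h0, h1, h2, h3, h4, h5, h6, h7, h8⟩ := indClassFun_one_apply_cyclicTimesSymThree g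
  rw [sum_fin_nine_smul_apply_c3s3]
  show (a 0 : ℂ) * indClassFun (⊥ : Subgroup (Multiplicative (ZMod 3) × DihedralGroup 3)) 1 g +
      (a 1 : ℂ) * indClassFun (Subgroup.zpowers ((1, sr 0) : Multiplicative (ZMod 3) × DihedralGroup 3)) 1 g +
      (a 2 : ℂ) * indClassFun (Subgroup.zpowers ((Multiplicative.ofAdd (1 : ZMod 3), (1 : DihedralGroup 3)) : Multiplicative (ZMod 3) × DihedralGroup 3)) 1 g +
      (a 3 : ℂ) * indClassFun (Subgroup.zpowers ((1, r 1) : Multiplicative (ZMod 3) × DihedralGroup 3)) 1 g +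
      (a 4 : ℂ) * indClassFun (Subgroup.zpowers ((Multiplicative.ofAdd (1 : ZMod 3), r 1) : Multiplicative (ZMod 3) × DihedralGroup 3)) 1 g +
      (a 5 : ℂ) * indClassFun (Subgroup.zpowers ((Multiplicative.ofAdd (1 : ZMod 3), sr 0) : Multiplicative (ZMod 3) × DihedralGroup 3)) 1 g +
      (a 6 : ℂ) * indClassFun ((⊥ : Subgroup (Multiplicative (ZMod 3))).prod (⊤ : Subgroup (DihedralGroup 3))) 1 g +
      (a 7 : ℂ) * indClassFun ((⊤ : Subgroup (Multiplicative (ZMod 3))).prod (Subgroup.zpowers (r 1 : DihedralGroup 3))) 1 g +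
      (a 8 : ℂ) * indClassFun (⊤ : Subgroup (Multiplicative (ZMod 3) × DihedralGroup 3)) 1 g = _
  rw [h0, h1, h2, h3, h4, h5, h6, h7, h8, mul_one]

/-- **The Brauer relations of `C_3 × S_3`** on `![1, C_2, C_3×1, 1×C_3, C_3^Δ, C_6, 1×S_3, C_3², G]`: `a ∈ K` iff
`a_3 = −a_0`, `a_4 = −2a_0 − a_1`, `a_5 = −2a_0 − a_1 − 2a_2`, `a_6 = −a_1`, `a_7 = 2a_0 + a_1 − a_2`,
`a_8 = 2a_0 + a_1 + 2a_2` (free `a_0, a_1, a_2`: rank `3` = the non-cyclic classes `1×S_3, C_3², G`).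
[cite: BartelDokchitser2015, §1.1; §2 ("the rank of K(G) is the number of conjugacy classes of non-cyclic subgroups")] -/
theorem sum_smul_indClassFun_cyclicTimesSymThree_eq_zero_iff (a : Fin 9 → ℤ) :
    ∑ i : Fin 9, (a i : ℂ) • indClassFun ((![⊥,
        Subgroup.zpowers ((1, sr 0) : Multiplicative (ZMod 3) × DihedralGroup 3),
        Subgroup.zpowers ((Multiplicative.ofAdd (1 : ZMod 3), (1 : DihedralGroup 3)) : Multiplicative (ZMod 3) × DihedralGroup 3),
        Subgroup.zpowers ((1, r 1) : Multiplicative (ZMod 3) × DihedralGroup 3),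
        Subgroup.zpowers ((Multiplicative.ofAdd (1 : ZMod 3), r 1) : Multiplicative (ZMod 3) × DihedralGroup 3),
        Subgroup.zpowers ((Multiplicative.ofAdd (1 : ZMod 3), sr 0) : Multiplicative (ZMod 3) × DihedralGroup 3),
        (⊥ : Subgroup (Multiplicative (ZMod 3))).prod (⊤ : Subgroup (DihedralGroup 3)),
        (⊤ : Subgroup (Multiplicative (ZMod 3))).prod (Subgroup.zpowers (r 1 : DihedralGroup 3)),
        ⊤] :
        Fin 9 → Subgroup (Multiplicative (ZMod 3) × DihedralGroup 3)) i) 1 = 0 ↔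
      a 3 = -a 0 ∧ a 4 = -2 * a 0 - a 1 ∧ a 5 = -2 * a 0 - a 1 - 2 * a 2 ∧ a 6 = -a 1 ∧
        a 7 = 2 * a 0 + a 1 - a 2 ∧ a 8 = 2 * a 0 + a 1 + 2 * a 2 := by
  constructor
  · intro h
    have e := fun g ↦ (sum_smul_indClassFun_cyclicTimesSymThree_apply a g).symm.trans (congr_fun h g)
    have e0 := e 1
    have e1 := e ((1, sr 0) : Multiplicative (ZMod 3) × DihedralGroup 3)
    have e2 := e ((Multiplicative.ofAdd (1 : ZMod 3), (1 : DihedralGroup 3)) : Multiplicative (ZMod 3) × DihedralGroup 3)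
    have e3 := e ((1, r 1) : Multiplicative (ZMod 3) × DihedralGroup 3)
    have e4 := e ((Multiplicative.ofAdd (1 : ZMod 3), r 1) : Multiplicative (ZMod 3) × DihedralGroup 3)
    have e5 := e ((Multiplicative.ofAdd (1 : ZMod 3), sr 0) : Multiplicative (ZMod 3) × DihedralGroup 3)
    simp (config := { decide := true }) only [Pi.zero_apply, if_true, if_false, mul_zero, add_zero] at e0 e1 e2 e3 e4 e5
    have i0 : ((18 * a 0 + 9 * a 1 + 6 * a 2 + 6 * a 3 + 6 * a 4 + 3 * a 5 + 3 * a 6 + 2 * a 7 + a 8 : ℤ) : ℂ) = 0 := by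
      push_cast; linear_combination e0
    have i1 : ((3 * a 1 + a 5 + 3 * a 6 + a 8 : ℤ) : ℂ) = 0 := by push_cast; linear_combination e1
    have i2 : ((6 * a 2 + 3 * a 5 + 2 * a 7 + a 8 : ℤ) : ℂ) = 0 := by push_cast; linear_combination e2
    have i3 : ((6 * a 3 + 3 * a 6 + 2 * a 7 + a 8 : ℤ) : ℂ) = 0 := by push_cast; linear_combination e3
    have i4 : ((3 * a 4 + 2 * a 7 + a 8 : ℤ) : ℂ) = 0 := by push_cast; linear_combination e4
    have i5 : ((a 5 + a 8 : ℤ) : ℂ) = 0 := by push_cast; linear_combination e5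
    norm_cast at i0 i1 i2 i3 i4 i5
    omega
  · rintro ⟨h3, h4, h5, h6, h7, h8⟩
    funext g
    rw [sum_smul_indClassFun_cyclicTimesSymThree_apply, Pi.zero_apply, h3, h4, h5, h6, h7, h8]
    push_cast
    rcases cyclicTimesSymThree_cases g with rfl | rfl | rfl | rfl | rfl | rfl | rfl | rfl | rfl | rfl | rfl | rfl | rfl | rfl | rfl | rfl | rfl | rfl <;>
    · simp (config := { decide := true }) only [if_true, if_false]
      ring

/-- **`Θ`, `Ind_{S_3}`, `Inf`, `Ind_{C_3²}` are relations** (a `Fin 4`-family): `0 ↦ Θ = −C_2 + C_3^Δ + C_6 + S_3 − C_3² − G`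
(Theorem A (3)(b), table formula with `N_Q U_1 = N_Q U_2 = Q`, `N_Q U_Δ = 1`), `1 ↦ Ind_{S_3} = 1 − 2C_2 − (1×C_3) + 2S_3`,
`2 ↦ Inf = (C_3×1) − 2C_6 − C_3² + 2G` (from `G/(C_3×1) ≅ S_3`), `3 ↦ Ind_{C_3²} = 1 − (C_3×1) − (1×C_3) − 2C_3^Δ + 3C_3²`.
[cite: BartelDokchitser2015, §1.1 Theorem A (3)(b) (table: "Θ = G − Q + Σ_U (U ⋊ N_Q U − 𝔽_l^d ⋊ N_Q U)"); §2 (Induction, Inflation, Examples 2–3)] -/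
theorem relations_mem_cyclicTimesSymThree (k : Fin 4) :
    ∑ i : Fin 9, (((![![0, -1, 0, 0, 1, 1, 1, -1, -1],
      ![1, -2, 0, -1, 0, 0, 2, 0, 0],
      ![0, 0, 1, 0, 0, -2, 0, -1, 2],
      ![1, 0, -1, -1, -2, 0, 0, 3, 0]] : Fin 4 → Fin 9 → ℤ) k i : ℤ) : ℂ) • indClassFun ((![⊥,
        Subgroup.zpowers ((1, sr 0) : Multiplicative (ZMod 3) × DihedralGroup 3),
        Subgroup.zpowers ((Multiplicative.ofAdd (1 : ZMod 3), (1 : DihedralGroup 3)) : Multiplicative (ZMod 3) × DihedralGroup 3),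
        Subgroup.zpowers ((1, r 1) : Multiplicative (ZMod 3) × DihedralGroup 3),
        Subgroup.zpowers ((Multiplicative.ofAdd (1 : ZMod 3), r 1) : Multiplicative (ZMod 3) × DihedralGroup 3),
        Subgroup.zpowers ((Multiplicative.ofAdd (1 : ZMod 3), sr 0) : Multiplicative (ZMod 3) × DihedralGroup 3),
        (⊥ : Subgroup (Multiplicative (ZMod 3))).prod (⊤ : Subgroup (DihedralGroup 3)),
        (⊤ : Subgroup (Multiplicative (ZMod 3))).prod (Subgroup.zpowers (r 1 : DihedralGroup 3)),
        ⊤] :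
        Fin 9 → Subgroup (Multiplicative (ZMod 3) × DihedralGroup 3)) i) 1 = 0 := by
  refine (sum_smul_indClassFun_cyclicTimesSymThree_eq_zero_iff _).2 ?_
  fin_cases k <;> simp

/-- **`2Θ = Ind_{S_3} − Ind_{C_3²} − Inf`** — twice the primitive relation is imprimitive. [cite: BartelDokchitser2015, §1.1 Theorem A (3)(b) ("ℤ/pℤ if Q ≠ {1}")] -/
theorem two_smul_thetaPrim_eq_cyclicTimesSymThree :
    (2 : ℤ) • (![0, -1, 0, 0, 1, 1, 1, -1, -1] : Fin 9 → ℤ) = ![1, -2, 0, -1, 0, 0, 2, 0, 0] - ![1, 0, -1, -1, -2, 0, 0, 3, 0] - ![0, 0, 1, 0, 0, -2, 0, -1, 2] := by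
  decide

end CyclicTimesSymThreeRelations

/-! ## §4 `K(C_3 × S_3) = ℤΘ ⊕ ℤInd_{S_3} ⊕ ℤInf`, rank `3`, `Prim = ℤ/2ℤ` -/

section CyclicTimesSymThreeLattice

variable (𝒦 : Submodule ℤ (Fin 9 → ℤ))
  (h𝒦 : ∀ a : Fin 9 → ℤ, a ∈ 𝒦 ↔ ∑ i : Fin 9, (a i : ℂ) • indClassFun ((![⊥,
        Subgroup.zpowers ((1, sr 0) : Multiplicative (ZMod 3) × DihedralGroup 3),
        Subgroup.zpowers ((Multiplicative.ofAdd (1 : ZMod 3), (1 : DihedralGroup 3)) : Multiplicative (ZMod 3) × DihedralGroup 3),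
        Subgroup.zpowers ((1, r 1) : Multiplicative (ZMod 3) × DihedralGroup 3),
        Subgroup.zpowers ((Multiplicative.ofAdd (1 : ZMod 3), r 1) : Multiplicative (ZMod 3) × DihedralGroup 3),
        Subgroup.zpowers ((Multiplicative.ofAdd (1 : ZMod 3), sr 0) : Multiplicative (ZMod 3) × DihedralGroup 3),
        (⊥ : Subgroup (Multiplicative (ZMod 3))).prod (⊤ : Subgroup (DihedralGroup 3)),
        (⊤ : Subgroup (Multiplicative (ZMod 3))).prod (Subgroup.zpowers (r 1 : DihedralGroup 3)),
        ⊤] :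
        Fin 9 → Subgroup (Multiplicative (ZMod 3) × DihedralGroup 3)) i) 1 = 0)
include h𝒦

/-- **Membership in `K(C_3 × S_3)` in coordinates.** [cite: BartelDokchitser2015, §1.1; §2] -/
theorem mem_brauerRelations_cyclicTimesSymThree_iff (a : Fin 9 → ℤ) :
    a ∈ 𝒦 ↔ a 3 = -a 0 ∧ a 4 = -2 * a 0 - a 1 ∧ a 5 = -2 * a 0 - a 1 - 2 * a 2 ∧ a 6 = -a 1 ∧
        a 7 = 2 * a 0 + a 1 - a 2 ∧ a 8 = 2 * a 0 + a 1 + 2 * a 2 :=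
  (h𝒦 a).trans (sum_smul_indClassFun_cyclicTimesSymThree_eq_zero_iff a)

/-- The four listed relations lie in `K`. [cite: BartelDokchitser2015, §1.1 Theorem A (3)(b); §2] -/
theorem relations_mem_brauerRelations_cyclicTimesSymThree (k : Fin 4) : (![![0, -1, 0, 0, 1, 1, 1, -1, -1],
      ![1, -2, 0, -1, 0, 0, 2, 0, 0],
      ![0, 0, 1, 0, 0, -2, 0, -1, 2],
      ![1, 0, -1, -1, -2, 0, 0, 3, 0]] : Fin 4 → Fin 9 → ℤ) k ∈ 𝒦 :=
  (h𝒦 _).2 (relations_mem_cyclicTimesSymThree k)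

/-- **Every relation of `C_3 × S_3` is `(−2a_0 − a_1)Θ + a_0·Ind_{S_3} + a_2·Inf`.** [cite: BartelDokchitser2015, §1.1 Theorem A (3)(b); §2] -/
theorem eq_combination_of_mem_brauerRelations_cyclicTimesSymThree {a : Fin 9 → ℤ} (ha : a ∈ 𝒦) :
    a = (-2 * a 0 - a 1) • (![0, -1, 0, 0, 1, 1, 1, -1, -1] : Fin 9 → ℤ) + a 0 • (![1, -2, 0, -1, 0, 0, 2, 0, 0] : Fin 9 → ℤ) + a 2 • (![0, 0, 1, 0, 0, -2, 0, -1, 2] : Fin 9 → ℤ) := by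
  obtain ⟨h3, h4, h5, h6, h7, h8⟩ := (mem_brauerRelations_cyclicTimesSymThree_iff 𝒦 h𝒦 a).1 ha
  funext i
  fin_cases i <;> simp <;> omega

/-- **`K(C_3 × S_3) = ℤΘ ⊕ ℤInd_{S_3} ⊕ ℤInf`.** [cite: BartelDokchitser2015, §1.1 Theorem A (3)(b); §2] -/
theorem brauerRelations_cyclicTimesSymThree_eq_span :
    𝒦 = Submodule.span ℤ {(![0, -1, 0, 0, 1, 1, 1, -1, -1] : Fin 9 → ℤ), ![1, -2, 0, -1, 0, 0, 2, 0, 0], ![0, 0, 1, 0, 0, -2, 0, -1, 2]} := by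
  refine le_antisymm (fun a ha ↦ ?_) (Submodule.span_le.2 ?_)
  · rw [eq_combination_of_mem_brauerRelations_cyclicTimesSymThree 𝒦 h𝒦 ha]
    exact Submodule.add_mem _ (Submodule.add_mem _ (Submodule.smul_mem _ _ (Submodule.subset_span (by simp)))
      (Submodule.smul_mem _ _ (Submodule.subset_span (by simp)))) (Submodule.smul_mem _ _ (Submodule.subset_span (by simp)))
  · rintro v (rfl | rfl | rfl)
    · exact relations_mem_brauerRelations_cyclicTimesSymThree 𝒦 h𝒦 0
    · exact relations_mem_brauerRelations_cyclicTimesSymThree 𝒦 h𝒦 1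
    · exact relations_mem_brauerRelations_cyclicTimesSymThree 𝒦 h𝒦 2

omit h𝒦 in
/-- The three basis vectors are linearly independent. [cite: BartelDokchitser2015, §2 ("clearly linearly independent")] -/
theorem linearIndependent_basis_cyclicTimesSymThree :
    LinearIndependent ℤ (![(![0, -1, 0, 0, 1, 1, 1, -1, -1] : Fin 9 → ℤ), ![1, -2, 0, -1, 0, 0, 2, 0, 0], ![0, 0, 1, 0, 0, -2, 0, -1, 2]] : Fin 3 → Fin 9 → ℤ) := by
  rw [Fintype.linearIndependent_iff]
  intro c hc i
  have e0 := congr_fun hc 0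
  have e1 := congr_fun hc 1
  have e2 := congr_fun hc 2
  simp [Fin.sum_univ_three] at e0 e1 e2
  fin_cases i <;> simp <;> omega

omit h𝒦 in
/-- The canonical lattice `K = ker(a ↦ Σ_i a_i (1_{H_i})^G)` is the span of the three basis vectors. [cite: BartelDokchitser2015, §2] -/
theorem ker_linearCombination_indClassFun_one_cyclicTimesSymThree_eq_span :
    LinearMap.ker (Fintype.linearCombination ℤ fun i : Fin 9 ↦ indClassFun ((![⊥,
        Subgroup.zpowers ((1, sr 0) : Multiplicative (ZMod 3) × DihedralGroup 3),
        Subgroup.zpowers ((Multiplicative.ofAdd (1 : ZMod 3), (1 : DihedralGroup 3)) : Multiplicative (ZMod 3) × DihedralGroup 3),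
        Subgroup.zpowers ((1, r 1) : Multiplicative (ZMod 3) × DihedralGroup 3),
        Subgroup.zpowers ((Multiplicative.ofAdd (1 : ZMod 3), r 1) : Multiplicative (ZMod 3) × DihedralGroup 3),
        Subgroup.zpowers ((Multiplicative.ofAdd (1 : ZMod 3), sr 0) : Multiplicative (ZMod 3) × DihedralGroup 3),
        (⊥ : Subgroup (Multiplicative (ZMod 3))).prod (⊤ : Subgroup (DihedralGroup 3)),
        (⊤ : Subgroup (Multiplicative (ZMod 3))).prod (Subgroup.zpowers (r 1 : DihedralGroup 3)),
        ⊤] :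
        Fin 9 → Subgroup (Multiplicative (ZMod 3) × DihedralGroup 3)) i) 1) =
      Submodule.span ℤ {(![0, -1, 0, 0, 1, 1, 1, -1, -1] : Fin 9 → ℤ), ![1, -2, 0, -1, 0, 0, 2, 0, 0], ![0, 0, 1, 0, 0, -2, 0, -1, 2]} :=
  brauerRelations_cyclicTimesSymThree_eq_span _ (mem_ker_linearCombination_indClassFun_one_iff _)

omit h𝒦 in
/-- **`rank K(C_3 × S_3) = 3`** (on the canonical lattice) — the non-cyclic classes `1 × S_3, C_3², G`. [cite: BartelDokchitser2015, §2] -/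
theorem finrank_ker_linearCombination_indClassFun_one_cyclicTimesSymThree :
    Module.finrank ℤ (LinearMap.ker (Fintype.linearCombination ℤ fun i : Fin 9 ↦ indClassFun ((![⊥,
        Subgroup.zpowers ((1, sr 0) : Multiplicative (ZMod 3) × DihedralGroup 3),
        Subgroup.zpowers ((Multiplicative.ofAdd (1 : ZMod 3), (1 : DihedralGroup 3)) : Multiplicative (ZMod 3) × DihedralGroup 3),
        Subgroup.zpowers ((1, r 1) : Multiplicative (ZMod 3) × DihedralGroup 3),
        Subgroup.zpowers ((Multiplicative.ofAdd (1 : ZMod 3), r 1) : Multiplicative (ZMod 3) × DihedralGroup 3),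
        Subgroup.zpowers ((Multiplicative.ofAdd (1 : ZMod 3), sr 0) : Multiplicative (ZMod 3) × DihedralGroup 3),
        (⊥ : Subgroup (Multiplicative (ZMod 3))).prod (⊤ : Subgroup (DihedralGroup 3)),
        (⊤ : Subgroup (Multiplicative (ZMod 3))).prod (Subgroup.zpowers (r 1 : DihedralGroup 3)),
        ⊤] :
        Fin 9 → Subgroup (Multiplicative (ZMod 3) × DihedralGroup 3)) i) 1)) = 3 := by
  rw [ker_linearCombination_indClassFun_one_cyclicTimesSymThree_eq_span]
  have h := linearIndependent_basis_cyclicTimesSymThree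
  rw [show ({(![0, -1, 0, 0, 1, 1, 1, -1, -1] : Fin 9 → ℤ), ![1, -2, 0, -1, 0, 0, 2, 0, 0], ![0, 0, 1, 0, 0, -2, 0, -1, 2]} : Set (Fin 9 → ℤ)) =
      Set.range (![(![0, -1, 0, 0, 1, 1, 1, -1, -1] : Fin 9 → ℤ), ![1, -2, 0, -1, 0, 0, 2, 0, 0], ![0, 0, 1, 0, 0, -2, 0, -1, 2]] : Fin 3 → Fin 9 → ℤ) by
    ext v
    simp only [Set.mem_insert_iff, Set.mem_singleton_iff, Set.mem_range]
    constructor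
    · rintro (rfl | rfl | rfl)
      exacts [⟨0, rfl⟩, ⟨1, rfl⟩, ⟨2, rfl⟩]
    · rintro ⟨i, rfl⟩
      fin_cases i <;> simp]
  rw [finrank_span_eq_card h, Fintype.card_fin]

omit h𝒦 in
/-- **On the imprimitive span `⟨Ind_{S_3}, Inf, Ind_{C_3²}⟩` the coefficient `a_G` is EVEN; on `Θ` it is `−1`: `Θ` is
PRIMITIVE.** [cite: BartelDokchitser2015, §1.1 Theorem A (3)(b) ("ℤ/pℤ if Q ≠ {1}")] -/
theorem thetaPrim_not_mem_span_imprimitive_cyclicTimesSymThree :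
    (![0, -1, 0, 0, 1, 1, 1, -1, -1] : Fin 9 → ℤ) ∉ Submodule.span ℤ {(![1, -2, 0, -1, 0, 0, 2, 0, 0] : Fin 9 → ℤ), ![0, 0, 1, 0, 0, -2, 0, -1, 2], ![1, 0, -1, -1, -2, 0, 0, 3, 0]} := by
  intro h
  have key : ∀ v ∈ Submodule.span ℤ {(![1, -2, 0, -1, 0, 0, 2, 0, 0] : Fin 9 → ℤ), ![0, 0, 1, 0, 0, -2, 0, -1, 2], ![1, 0, -1, -1, -2, 0, 0, 3, 0]}, (2 : ℤ) ∣ v 8 := by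
    intro v hv
    refine Submodule.span_induction (p := fun v _ ↦ (2 : ℤ) ∣ v 8) ?_ ?_ ?_ ?_ hv
    · intro w hw
      simp only [Set.mem_insert_iff, Set.mem_singleton_iff] at hw
      rcases hw with rfl | rfl | rfl <;> decide
    · simp
    · intro x y _ _ hx hy
      simp only [Pi.add_apply]
      exact dvd_add hx hy
    · intro c x _ hx
      simp only [Pi.smul_apply, smul_eq_mul]
      exact Dvd.dvd.mul_left hx c
  have h2 := key _ h
  revert h2
  decide

omit h𝒦 in
/-- **`2Θ` IS in that span.** [cite: BartelDokchitser2015, §1.1 Theorem A (3)(b)] -/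
theorem two_smul_thetaPrim_mem_span_imprimitive_cyclicTimesSymThree :
    (2 : ℤ) • (![0, -1, 0, 0, 1, 1, 1, -1, -1] : Fin 9 → ℤ) ∈ Submodule.span ℤ {(![1, -2, 0, -1, 0, 0, 2, 0, 0] : Fin 9 → ℤ), ![0, 0, 1, 0, 0, -2, 0, -1, 2], ![1, 0, -1, -1, -2, 0, 0, 3, 0]} := by
  rw [two_smul_thetaPrim_eq_cyclicTimesSymThree]
  exact Submodule.sub_mem _ (Submodule.sub_mem _ (Submodule.subset_span (by simp)) (Submodule.subset_span (by simp)))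
    (Submodule.subset_span (by simp))

/-- **`K(C_3 × S_3) = ℤΘ + Imprim`**: with the two previous theorems, `Prim = K/Imprim ≅ ℤ/2ℤ` generated by `Θ`.
[cite: BartelDokchitser2015, §1.1 Theorem A (3)(b) (table, case 3b: "ℤ/pℤ if Q ≠ {1}")] -/
theorem brauerRelations_cyclicTimesSymThree_eq_span_thetaPrim_sup_imprimitive :
    𝒦 = Submodule.span ℤ {(![0, -1, 0, 0, 1, 1, 1, -1, -1] : Fin 9 → ℤ)} ⊔ Submodule.span ℤ {(![1, -2, 0, -1, 0, 0, 2, 0, 0] : Fin 9 → ℤ), ![0, 0, 1, 0, 0, -2, 0, -1, 2], ![1, 0, -1, -1, -2, 0, 0, 3, 0]} := by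
  refine le_antisymm ?_ (sup_le ((Submodule.span_singleton_le_iff_mem _ _).2
    (relations_mem_brauerRelations_cyclicTimesSymThree 𝒦 h𝒦 0)) (Submodule.span_le.2 ?_))
  · rw [brauerRelations_cyclicTimesSymThree_eq_span 𝒦 h𝒦, Submodule.span_le]
    rintro v (rfl | rfl | rfl)
    · exact Submodule.mem_sup_left (Submodule.subset_span rfl)
    · exact Submodule.mem_sup_right (Submodule.subset_span (by simp))
    · exact Submodule.mem_sup_right (Submodule.subset_span (by simp))
  · rintro v (rfl | rfl | rfl)
    · exact relations_mem_brauerRelations_cyclicTimesSymThree 𝒦 h𝒦 1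
    · exact relations_mem_brauerRelations_cyclicTimesSymThree 𝒦 h𝒦 2
    · exact relations_mem_brauerRelations_cyclicTimesSymThree 𝒦 h𝒦 3

end CyclicTimesSymThreeLattice

end AbelianVariety

end Literature.AlgebraicGeometry.Motives
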